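import Summits.BirchSwinnertonDyer.BirchSwinnertonDyer.Theorems.ResidualThetaTransportAtTwoThetaLayerLambdaCongruenceAtTwoCuspSpanB1GenTwoPrimes
import Summits.BirchSwinnertonDyer.BirchSwinnertonDyer.Theorems.ResidualThetaTransportAtTwoThetaLayerLambdaCongruenceAtTwoCuspSpanCharacterOdd
import HarnessLib

/-!
# Route `ResidualThetaTransportAtTwo`, cruxes Kan⁺ (stmt-BirchSwinnertonDyer-20688) / node 27436 `CuspSpanEvenAtTwoOdd` / 21437:
# **the node `CuspSpanEvenAtTwo (p·q)` at EVERY SQUAREFREE TWO-PRIME ODD LEVEL** — the first uniform composite family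

Cell `bsd-wall`, lead prover `bsd-wall-rtt-p3` g10 (2026-08-28). THEOREMS ONLY (no `def`, no `sorry`);
`--supports stmt-BirchSwinnertonDyer-20688`; BSD is not proved by this.

COMPOSITION of two kernel theorems landed today:
* `cuspSpanEvenAtTwo_of_forall_b1_odd` (width seat `bsd-wall-rtt-p3-w4` g2, `…CuspSpanCharacterOdd`): at every odd level `N` the
  node (G′)_N follows from (G‴)_N «every ADMISSIBLE `χ : Γ₀(N) → 𝔽₂` (additive, killing the elements of trace `0, ±1, ±2` and the
  `4^k`-elements) that vanishes on `B₁ = {b = −1}` vanishes identically» — the `B₁`-character of an admissible `χ` being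
  multiplicative (three-fold products of `rtt-p3-w2` g4 / `rtt-p3-w4` g2, 4-invariance and sign companions of `rtt-p3-w5` g2);
* `Potential.chi_eq_zero_of_forall_b_neg_one_twoPrimes` (this seat, `…CuspSpanB1GenTwoPrimes`): at `N = pq`, `p ≠ q` primes, (G‴)_N
  holds — indeed WITHOUT the `4^k`-hypothesis: an additive `χ` killing the trace-`±2` elements and `B₁` is zero (potential on
  primitive vectors, symbol calculus on `P¹(ℤ/pq)`, `SL₂(ℤ) = ⟨S, T⟩`).
Hence **`cuspSpanEvenAtTwo_twoPrimes : CuspSpanEvenAtTwo (p * q)`** for all distinct odd primes `p, q` (`cuspSpanEvenAtTwo_of_eq_twoPrimes`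
for a level `N = pq` given by an equation; `cuspSpanTrace_twoPrimes` the trace form), and **`flatAtTwo_of_conductor_twoPrimes`**:
FLAT (crux Kμ⁺'s `2 ∤ L⁻` for every Pollack pair at `2`) for every `W/ℚ` good supersingular at `2` with `a₂ = 0` and conductor `pq`.

STATE OF THE NODE (27436 = `∀ odd N, CuspSpanEvenAtTwo N`) after this file: a kernel theorem at every odd `N` of the form `p^a`
(`cuspSpanEvenAtTwo_odd_primePow`, rtt-p3-w4 g2; `p` prime: `cuspSpanEvenAtTwo_prime`, rtt-p3-w2 g4) or `pq`; per-level descent tables at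
the other odd `N < 100` (rtt-p3-w2 g3). NOT covered: `p^a q^b` with `a + b ≥ 3` and three or more primes (e.g. the census habitat⁺ conductors
`11475 = 3³·5²·17`, `14157 = 3²·11²·13`) — at three primes (G‴) is FALSE as a statement about `χ` killing only `B₁` and the small traces
(`φ(105)/2 = 24 < 26 = 2g(X₀(105))`): the `4^k`-classes must enter the symbol calculus.

References: [Manin1972] §1.5–1.7, Thm. 1.9; [Rademacher1929] §1; [Knapp1993] Prop. 11.1; [Pollack2003] Conj. 6.3, Prop. 6.18.
-/

set_option autoImplicit false
set_option linter.dupNamespace false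

noncomputable section

open scoped MatrixGroups

open CongruenceSubgroup WeierstrassCurve Literature.NumberTheory.EllipticCurves
  Literature.NumberTheory.EllipticCurves.ModularForms Literature.NumberTheory.EllipticCurves.Rank1Residual
  Literature.NumberTheory.IwasawaTheory Summit.BirchSwinnertonDyer.Rank1Residual.Supersingular

namespace Summit.BirchSwinnertonDyer.BirchSwinnertonDyer.Theorems.SignedMuAtTwo

section TwoPrimes

variable {p q N : ℕ}

/-- **The trace form (G″)_N at every level `N = pq`, `p ≠ q` odd primes**: every admissible `χ : Γ₀(N) → 𝔽₂` is `ψ ∘ d̄` with `ψ`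
multiplicative on units (`cuspSpanTrace_of_forall_b1_odd` of rtt-p3-w4 + this seat's `B₁`-generation mod 2 at level `pq`).
[cite: Pollack2003, Conj. 6.3] [cite: Manin1972, Thm. 1.9] -/
theorem cuspSpanTrace_twoPrimes (hp : p.Prime) (hq : q.Prime) (hpq : p ≠ q) (hp2 : p ≠ 2) (hq2 : q ≠ 2) (hN : N = p * q) :
    ∀ χ : Gamma0 N → ZMod 2,
      (∀ γ δ : Gamma0 N, χ (γ * δ) = χ γ + χ δ) →
      (∀ γ : Gamma0 N, ((γ : SL(2, ℤ)) 0 0 + (γ : SL(2, ℤ)) 1 1).natAbs ≤ 2 → χ γ = 0) →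
      (∀ γ : Gamma0 N, (∃ k : ℕ, 1 ≤ k ∧ ((γ : SL(2, ℤ)) 1 1).natAbs = 4 ^ k) → χ γ = 0) →
      ∃ ψ : ZMod N → ZMod 2, (∀ x y : ZMod N, IsUnit x → IsUnit y → ψ (x * y) = ψ x + ψ y) ∧
        ∀ γ : Gamma0 N, χ γ = ψ ((((γ : SL(2, ℤ)) 1 1 : ℤ) : ZMod N)) :=
  have hNodd : Odd N := by rw [hN]; exact (hp.odd_of_ne_two hp2).mul (hq.odd_of_ne_two hq2)
  cuspSpanTrace_of_forall_b1_odd hNodd fun χ' hadd hsmall _ hB1 ↦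
    Potential.chi_eq_zero_of_forall_b_neg_one_twoPrimes hp hq hpq hN hadd hsmall hB1

/-- **`CuspSpanEvenAtTwo N` for every `N = pq`, `p ≠ q` odd primes** (level given by an equation). BSD is not proved by this.
[cite: Pollack2003, Conj. 6.3] [cite: Manin1972, Thm. 1.9] -/
theorem cuspSpanEvenAtTwo_of_eq_twoPrimes [NeZero N] (hp : p.Prime) (hq : q.Prime) (hpq : p ≠ q) (hp2 : p ≠ 2) (hq2 : q ≠ 2)
    (hN : N = p * q) : CuspSpanEvenAtTwo N :=
  cuspSpanEvenAtTwo_of_cuspSpanTrace (cuspSpanTrace_twoPrimes hp hq hpq hp2 hq2 hN)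

/-- **`CuspSpanEvenAtTwo (p * q)` for all distinct odd primes `p, q`** — the node (G′)_N of 21437 / Kan⁺ / Kμ⁺ / TP2-K1 at every
squarefree two-prime odd level, uniformly, with no certificate and no conjecture-grade input: the first uniform COMPOSITE family.
BSD is not proved by this. [cite: Pollack2003, Conj. 6.3] [cite: Manin1972, Thm. 1.9] -/
theorem cuspSpanEvenAtTwo_twoPrimes (hp : p.Prime) (hq : q.Prime) (hpq : p ≠ q) (hp2 : p ≠ 2) (hq2 : q ≠ 2)
    [NeZero (p * q)] : CuspSpanEvenAtTwo (p * q) :=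
  cuspSpanEvenAtTwo_of_eq_twoPrimes hp hq hpq hp2 hq2 rfl

/-- Instances: the node at `15, 21, 33, 35` BY NAME from the uniform theorem (these four also have descent-table proofs by
rtt-p3-w2 g3; the uniform theorem covers every `pq`, e.g. `51 = 3·17`, `267 = 3·89`, `335`, `1115`, …). [cite: Pollack2003, Conj. 6.3] -/
theorem cuspSpanEvenAtTwo_twoPrimes_examples :
    CuspSpanEvenAtTwo 15 ∧ CuspSpanEvenAtTwo 21 ∧ CuspSpanEvenAtTwo 33 ∧ CuspSpanEvenAtTwo 35 ∧ CuspSpanEvenAtTwo 267 :=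
  ⟨cuspSpanEvenAtTwo_of_eq_twoPrimes (p := 3) (q := 5) Nat.prime_three Nat.prime_five (by decide) (by decide) (by decide) rfl,
    cuspSpanEvenAtTwo_of_eq_twoPrimes (p := 3) (q := 7) Nat.prime_three (by norm_num) (by decide) (by decide) (by decide) rfl,
    cuspSpanEvenAtTwo_of_eq_twoPrimes (p := 3) (q := 11) Nat.prime_three (by norm_num) (by decide) (by decide) (by decide) rfl,
    cuspSpanEvenAtTwo_of_eq_twoPrimes (p := 5) (q := 7) Nat.prime_five (by norm_num) (by decide) (by decide) (by decide) rfl,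
    cuspSpanEvenAtTwo_of_eq_twoPrimes (p := 3) (q := 89) Nat.prime_three (by norm_num) (by decide) (by decide) (by decide) rfl⟩

end TwoPrimes

/-! ## FLAT for habitat⁺ curves of conductor `pq` -/

section Flat

variable {W : WeierstrassCurve ℚ} [W.IsElliptic] [W.IsGloballyMinimal]

/-- **FLAT at every squarefree two-prime odd conductor.** For `W/ℚ` good supersingular at `2` with `a₂(W) = 0`, newform `f`, and
conductor `N_W = pq` (`p ≠ q` odd primes): `2 ∤ L⁻` for every Pollack pair `(L⁺, L⁻)` of `f` at `2` — crux Kμ⁺'s FLAT statement on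
this sub-habitat, by `flatAtTwo_of_cuspSpanEvenAtTwo` and `cuspSpanEvenAtTwo_of_eq_twoPrimes`. BSD is not proved by this.
[cite: Pollack2003, Conj. 6.3 and Prop. 6.18] -/
theorem flatAtTwo_of_conductor_twoPrimes [NeZero (W.conductorNorm ℤ)] {f : CuspForm (Gamma0 (W.conductorNorm ℤ)) 2}
    (hf : IsNewformOf W f) (hss : GoodSS W 2) (ha2 : W.frobeniusTrace 2 = 0)
    {p q : ℕ} (hp : p.Prime) (hq : q.Prime) (hpq : p ≠ q) (hp2 : p ≠ 2) (hq2 : q ≠ 2) (hN : W.conductorNorm ℤ = p * q) :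
    ∀ Lplus Lminus : IwasawaAlgebra 2, IsPollackPair f 2 Lplus Lminus → ¬ PowerSeries.C (2 : ℤ_[2]) ∣ Lminus :=
  flatAtTwo_of_cuspSpanEvenAtTwo hf hss ha2 (cuspSpanEvenAtTwo_of_eq_twoPrimes hp hq hpq hp2 hq2 hN)

end Flat

end Summit.BirchSwinnertonDyer.BirchSwinnertonDyer.Theorems.SignedMuAtTwo

end
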